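import Literature.Analysis.Complex.HolomorphicParametricIntegral
import Literature.Analysis.Complex.FlatTubeFourier
import Mathlib.Analysis.SpecialFunctions.Gaussian.FourierTransform
import Mathlib.Analysis.Fourier.Inversion
import Mathlib.Analysis.Complex.CauchyIntegral
import Mathlib.Analysis.Convex.Combination
import HarnessLib

/-!
# Bochner's tube theorem by Fourier analysis, I: the windowed Fourier data of a holomorphic function on a tube

Analysis/Complex support file (everything proved; no named facts). Let `B ⊆ ℝᵏ` be open and
star-shaped with respect to `0`, and let `F` be holomorphic on the **tube** `T(B) = ℝᵏ + iB`
(`tube B`, points `x + iy` written `cpt x y`) and bounded on `ℝᵏ + iK` for every compact `K ⊆ B`.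
With the Gaussian window `G_b(z) = e^{-b∑ z_j²}` (`gw b`), the **windowed Fourier data at height
`y`**

  `Ψ_y(p) = ∫_{ℝᵏ} F(x + iy) G_b(x + iy) e^{-2πi p·(x + iy)} dx`   (`windowFT F b y p`)

is `e^{2π p·y}` times the Fourier transform of the slice `x ↦ F(x+iy) G_b(x+iy)`. This file proves:

* `windowFT_add_eq` / `windowFT_eq_windowFT_zero` — **height independence**: `Ψ_y = Ψ_0` for
  `y ∈ B`. Proof without iterated integrals: `κ ↦ ∫ F G_b e^{…}((x + iy) + κv) dx` is holomorphic
  in a strip (dominated holomorphic parameter integral,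
  `Literature.Analysis.Complex.differentiableOn_integral_of_dominated`), constant on the real
  axis by translation invariance of Lebesgue measure, hence constant (identity theorem), and its
  value at `κ = i` is `Ψ_{y+v}`;
* `norm_windowFT_le` — the trivial bound `‖Ψ_y(p)‖ ≤ M_y e^{b‖y‖²} (π/b)^{k/2} e^{2π p·y}`;
* `norm_windowFT_zero_le_of_surround` — **exponential decay at interior points of the convex
  hull**: if finitely many heights `y ∈ S ⊆ B` *surround* `y⋆` (for every `p` some `y ∈ S` has
  `(y - y⋆)·p ≤ -δ‖p‖`) then `‖Ψ_0(p)‖ ≤ A e^{2π p·y⋆} e^{-2πδ‖p‖}`; and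
  `exists_surround_of_mem_convexHull` — every point of `conv B` is so surrounded (`B` open);
* `apply_mul_gw_eq_integral_windowFT` — **Fourier inversion on the tube**:
  `F(z) G_b(z) = ∫ Ψ_0(p) e^{2πi p·z} dp` for `z ∈ T(B)`.

The sequel `BochnerTubeFourier` defines the extension `G_b(z)⁻¹ ∫ Ψ_0(p) e^{2πi p·z} dp` on
`T(conv B)` and proves Bochner's tube theorem with the sharp maximum principle. This Fourier route
to the tube theorem for functions of slow growth is classical (Bochner 1938; Vladimirov, *Methods
of the Theory of Functions of Many Complex Variables* (1966), §20; Hörmander, *An Introduction to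
Complex Analysis in Several Variables*, Thm. 2.5.10 for the general statement); it is the form
used by Osterwalder–Schrader II (Comm. Math. Phys. 42 (1975), Ch. V, (5.22)–(5.23): "the regions
`C_k^{(N)}` are mapped onto tubular domains under `ζ_i = e^{w_i}` … by the tube theorem
`c_k^{(N)}` = convex hull of …"). Everything here is elementary and tagged folklore.
-/

noncomputable section

open _root_.Complex Set MeasureTheory Filter Metric Real
open scoped _root_.Topology FourierTransform RealInnerProductSpace

namespace Literature.Analysis.Complex

namespace TubeFourier

variable {k : ℕ}

local notation "𝕍" => EuclideanSpace ℝ (Fin k)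

/-! ### Complex points `x + iy`, the tube over a base -/

/-- The complex point `x + iy ∈ ℂᵏ` with real part `x` and imaginary part `y`. [folklore] -/
def cpt (x y : 𝕍) : Fin k → ℂ := fun j => (x j : ℂ) + (y j : ℂ) * I

/-- The vector of imaginary parts of a point of `ℂᵏ`. [folklore] -/
def imv (z : Fin k → ℂ) : 𝕍 := WithLp.toLp 2 fun j => (z j).im

/-- The vector of real parts of a point of `ℂᵏ`. [folklore] -/
def rev (z : Fin k → ℂ) : 𝕍 := WithLp.toLp 2 fun j => (z j).re

/-- Coordinates of `x + iy`. [folklore] -/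
@[simp] theorem cpt_apply (x y : 𝕍) (j : Fin k) : cpt x y j = (x j : ℂ) + (y j : ℂ) * I := rfl

/-- Coordinates of the imaginary-part vector. [folklore] -/
@[simp] theorem imv_apply (z : Fin k → ℂ) (j : Fin k) : imv z j = (z j).im := rfl

/-- Coordinates of the real-part vector. [folklore] -/
@[simp] theorem rev_apply (z : Fin k → ℂ) (j : Fin k) : rev z j = (z j).re := rfl

/-- `Im (x + iy) = y`. [folklore] -/
@[simp] theorem imv_cpt (x y : 𝕍) : imv (cpt x y) = y := by
  ext j; simp [imv, cpt]

/-- `Re (x + iy) = x`. [folklore] -/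
@[simp] theorem rev_cpt (x y : 𝕍) : rev (cpt x y) = x := by
  ext j; simp [rev, cpt]

/-- `z = Re z + i Im z`. [folklore] -/
@[simp] theorem cpt_rev_imv (z : Fin k → ℂ) : cpt (rev z) (imv z) = z := by
  funext j; simp [cpt, Complex.re_add_im]

/-- Addition of complex points in real/imaginary coordinates. [folklore] -/
theorem cpt_add_cpt (x y x' y' : 𝕍) : cpt x y + cpt x' y' = cpt (x + x') (y + y') := by
  funext j; simp [cpt]; ring

/-- `Im` is additive. [folklore] -/
theorem imv_add (z w : Fin k → ℂ) : imv (z + w) = imv z + imv w := by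
  ext j; simp [imv]

/-- `Im` commutes with real scalars. [folklore] -/
theorem imv_smul (c : ℝ) (z : Fin k → ℂ) : imv (c • z) = c • imv z := by
  ext j; simp [imv]

/-- `Im` is continuous. [folklore] -/
theorem continuous_imv : Continuous (imv : (Fin k → ℂ) → 𝕍) := by
  refine (PiLp.continuous_toLp 2 _).comp ?_
  exact continuous_pi fun j => Complex.continuous_im.comp (continuous_apply j)

/-- `Re` is continuous. [folklore] -/
theorem continuous_rev : Continuous (rev : (Fin k → ℂ) → 𝕍) := by
  refine (PiLp.continuous_toLp 2 _).comp ?_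
  exact continuous_pi fun j => Complex.continuous_re.comp (continuous_apply j)

/-- `x ↦ x + iy` is continuous. [folklore] -/
theorem continuous_cpt_left (y : 𝕍) : Continuous fun x : 𝕍 => cpt x y := by
  refine continuous_pi fun j => ?_
  simp only [cpt_apply]
  exact ((Complex.continuous_ofReal.comp (PiLp.continuous_apply 2 _ j))).add continuous_const

/-- The sup norm of a complex point controls each imaginary part. [folklore] -/
theorem abs_im_sub_le_norm (z w : Fin k → ℂ) (j : Fin k) : |(z j).im - (w j).im| ≤ ‖z - w‖ := by
  calc |(z j).im - (w j).im| = |((z - w) j).im| := by simp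
    _ ≤ ‖(z - w) j‖ := Complex.abs_im_le_norm _
    _ ≤ ‖z - w‖ := norm_le_pi_norm _ j

/-- `‖imv z - imv w‖ ≤ √k ‖z - w‖`. [folklore] -/
theorem norm_imv_sub_le (z w : Fin k → ℂ) : ‖imv z - imv w‖ ≤ Real.sqrt k * ‖z - w‖ := by
  have h1 : ‖imv z - imv w‖ ^ 2 ≤ (Real.sqrt k * ‖z - w‖) ^ 2 := by
    rw [EuclideanSpace.norm_sq_eq, mul_pow, Real.sq_sqrt (Nat.cast_nonneg _)]
    calc ∑ j, ‖(imv z - imv w) j‖ ^ 2 ≤ ∑ _j : Fin k, ‖z - w‖ ^ 2 := by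
          refine Finset.sum_le_sum fun j _ => ?_
          have h := abs_im_sub_le_norm z w j
          rw [show ‖(imv z - imv w) j‖ = |(z j).im - (w j).im| by simp [Real.norm_eq_abs]]
          exact pow_le_pow_left₀ (abs_nonneg _) h 2
      _ = (k : ℝ) * ‖z - w‖ ^ 2 := by simp
  exact le_of_pow_le_pow_left₀ two_ne_zero (by positivity) h1

/-- The **tube** `ℝᵏ + iB` over a base `B ⊆ ℝᵏ`. [folklore] -/
def tube (B : Set 𝕍) : Set (Fin k → ℂ) := imv ⁻¹' B

/-- Membership in the tube. [folklore] -/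
theorem mem_tube {B : Set 𝕍} {z : Fin k → ℂ} : z ∈ tube B ↔ imv z ∈ B := Iff.rfl

/-- `x + iy ∈ T(B) ↔ y ∈ B`. [folklore] -/
theorem cpt_mem_tube {B : Set 𝕍} {x y : 𝕍} : cpt x y ∈ tube B ↔ y ∈ B := by
  simp [mem_tube]

/-- The tube over an open base is open. [folklore] -/
theorem isOpen_tube {B : Set 𝕍} (hB : IsOpen B) : IsOpen (tube B) :=
  hB.preimage continuous_imv

/-- Tubes are monotone in the base. [folklore] -/
theorem tube_mono {B B' : Set 𝕍} (h : B ⊆ B') : tube B ⊆ tube B' := preimage_mono h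

/-- The tube over a convex base is convex. [folklore] -/
theorem convex_tube {B : Set 𝕍} (hB : Convex ℝ B) : Convex ℝ (tube B) := by
  intro z hz w hw a c ha hc hac
  rw [mem_tube] at hz hw ⊢
  rw [imv_add, imv_smul, imv_smul]
  exact hB hz hw ha hc hac

/-! ### The Gaussian window and the phase -/

/-- The Gaussian window `G_b(z) = e^{-b ∑ z_j²}`. [folklore] -/
def gw (b : ℝ) (z : Fin k → ℂ) : ℂ := cexp (-(b : ℂ) * ∑ j, z j ^ 2)

/-- The phase `e^{-2πi ∑ p_j z_j}`. [folklore] -/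
def phase (p : 𝕍) (z : Fin k → ℂ) : ℂ := cexp (-(2 * π * I) * ∑ j, (p j : ℂ) * z j)

/-- The Gaussian window never vanishes. [folklore] -/
theorem gw_ne_zero (b : ℝ) (z : Fin k → ℂ) : gw b z ≠ 0 := Complex.exp_ne_zero _

/-- The Gaussian window is entire. [folklore] -/
theorem differentiable_gw (b : ℝ) : Differentiable ℂ (gw (k := k) b) := by
  unfold gw
  refine Complex.differentiable_exp.comp ((differentiable_const _).mul ?_)
  exact Differentiable.fun_sum fun j _ => (differentiable_apply j).pow 2

/-- The phase is entire. [folklore] -/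
theorem differentiable_phase (p : 𝕍) : Differentiable ℂ (phase (k := k) p) := by
  unfold phase
  refine Complex.differentiable_exp.comp ((differentiable_const _).mul ?_)
  exact Differentiable.fun_sum fun j _ => (differentiable_const _).mul (differentiable_apply j)

/-- The Gaussian window is continuous. [folklore] -/
theorem continuous_gw (b : ℝ) : Continuous (gw (k := k) b) := (differentiable_gw b).continuous

/-- The phase is continuous. [folklore] -/
theorem continuous_phase (p : 𝕍) : Continuous (phase (k := k) p) := (differentiable_phase p).continuous

/-- `∑ (x_j + iy_j)² = (‖x‖² - ‖y‖²) + 2i x·y` — real part. [folklore] -/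
theorem re_sum_cpt_sq (x y : 𝕍) : (∑ j, cpt x y j ^ 2).re = ‖x‖ ^ 2 - ‖y‖ ^ 2 := by
  rw [EuclideanSpace.norm_sq_eq, EuclideanSpace.norm_sq_eq, Complex.re_sum, ← Finset.sum_sub_distrib]
  refine Finset.sum_congr rfl fun j _ => ?_
  simp only [cpt_apply, Real.norm_eq_abs, sq_abs]
  rw [sq, Complex.mul_re]
  simp
  ring

/-- `‖G_b(x + iy)‖ = e^{-b(‖x‖² - ‖y‖²)}`. [folklore] -/
theorem norm_gw_cpt (b : ℝ) (x y : 𝕍) : ‖gw b (cpt x y)‖ = Real.exp (-b * (‖x‖ ^ 2 - ‖y‖ ^ 2)) := by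
  rw [gw, Complex.norm_exp]
  congr 1
  rw [show (-(b : ℂ) * ∑ j, cpt x y j ^ 2) = ((-b : ℝ) : ℂ) * ∑ j, cpt x y j ^ 2 by push_cast; ring,
    Complex.re_ofReal_mul, re_sum_cpt_sq]

/-- `∑ p_j (x_j + i y_j)` has real part `x·p` and imaginary part `y·p`. [folklore] -/
theorem sum_mul_cpt (p x y : 𝕍) :
    ∑ j, (p j : ℂ) * cpt x y j = ((⟪x, p⟫ : ℝ) : ℂ) + ((⟪y, p⟫ : ℝ) : ℂ) * I := by
  simp only [cpt_apply, PiLp.inner_apply, RCLike.inner_apply, conj_trivial]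
  push_cast
  rw [Finset.sum_mul, ← Finset.sum_add_distrib]
  refine Finset.sum_congr rfl fun j _ => ?_
  ring

/-- `‖e^{-2πi p·(x+iy)}‖ = e^{2π y·p}`. [folklore] -/
theorem norm_phase_cpt (p x y : 𝕍) : ‖phase p (cpt x y)‖ = Real.exp (2 * π * ⟪y, p⟫) := by
  rw [phase, Complex.norm_exp, sum_mul_cpt]
  congr 1
  simp only [neg_mul, Complex.neg_re, Complex.mul_re, Complex.add_re, Complex.ofReal_re,
    Complex.mul_im, Complex.ofReal_im, Complex.I_re, Complex.I_im, Complex.add_im,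
    Complex.re_ofNat, Complex.im_ofNat, Complex.ofReal_re, Complex.ofReal_im]
  simp

/-- The phase at `x + iy` factors as `e^{2π y·p} · e^{-2πi x·p}`. [folklore] -/
theorem phase_cpt (p x y : 𝕍) :
    phase p (cpt x y) = (Real.exp (2 * π * ⟪y, p⟫) : ℂ) * cexp (↑(-2 * π * ⟪x, p⟫) * I) := by
  rw [phase, sum_mul_cpt, Complex.ofReal_exp, ← Complex.exp_add]
  congr 1
  push_cast
  ring_nf
  rw [Complex.I_sq]
  ring

/-! ### The holomorphic integrand and the slices -/

variable (F : (Fin k → ℂ) → ℂ) (b : ℝ)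

/-- The integrand `H_p(z) = F(z) G_b(z) e^{-2πi p·z}`. [folklore] -/
def integrand (p : 𝕍) (z : Fin k → ℂ) : ℂ := F z * gw b z * phase p z

/-- The Gaussian-windowed slice at height `y`: `x ↦ F(x + iy) G_b(x + iy)`. [folklore] -/
def slice (y : 𝕍) (x : 𝕍) : ℂ := F (cpt x y) * gw b (cpt x y)

/-- The **windowed Fourier data at height `y`**: `Ψ_y(p) = ∫ F(x+iy) G_b(x+iy) e^{-2πi p·(x+iy)} dx`. [folklore] -/
def windowFT (y p : 𝕍) : ℂ := ∫ x : 𝕍, integrand F b p (cpt x y)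

variable {F b}

/-- The integrand at `x + iy` in terms of the slice: `H_p(x+iy) = e^{2π y·p} e^{-2πi x·p} slice_y(x)`. [folklore] -/
theorem integrand_cpt (p x y : 𝕍) :
    integrand F b p (cpt x y) =
      (Real.exp (2 * π * ⟪y, p⟫) : ℂ) * (cexp (↑(-2 * π * ⟪x, p⟫) * I) * slice F b y x) := by
  rw [integrand, phase_cpt, slice]
  ring

/-- `Ψ_y(p) = e^{2π y·p} 𝓕(slice_y)(p)`. [folklore] -/
theorem windowFT_eq_fourier (y p : 𝕍) :
    windowFT F b y p = (Real.exp (2 * π * ⟪y, p⟫) : ℂ) * 𝓕 (slice F b y) p := by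
  rw [windowFT, Real.fourier_eq']
  simp_rw [integrand_cpt, smul_eq_mul]
  exact integral_const_mul _ _

/-- The integrand is holomorphic where `F` is. [folklore] -/
theorem differentiableOn_integrand {U : Set (Fin k → ℂ)} (hF : DifferentiableOn ℂ F U) (p : 𝕍) :
    DifferentiableOn ℂ (integrand F b p) U :=
  (hF.mul (differentiable_gw b).differentiableOn).mul (differentiable_phase p).differentiableOn

/-- The integrand is continuous where `F` is. [folklore] -/
theorem continuousOn_integrand {U : Set (Fin k → ℂ)} (hF : ContinuousOn F U) (p : 𝕍) :
    ContinuousOn (integrand F b p) U :=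
  (hF.mul (continuous_gw b).continuousOn).mul (continuous_phase p).continuousOn

/-- Norm of the integrand at `x + iy` under a bound `‖F(x+iy)‖ ≤ M`. [folklore] -/
theorem norm_integrand_cpt_le {M : ℝ} {p x y : 𝕍} (hM : ‖F (cpt x y)‖ ≤ M) :
    ‖integrand F b p (cpt x y)‖ ≤
      M * Real.exp (b * ‖y‖ ^ 2) * Real.exp (2 * π * ⟪y, p⟫) * Real.exp (-b * ‖x‖ ^ 2) := by
  rw [integrand, norm_mul, norm_mul, norm_gw_cpt, norm_phase_cpt]
  have h1 : Real.exp (-b * (‖x‖ ^ 2 - ‖y‖ ^ 2)) = Real.exp (b * ‖y‖ ^ 2) * Real.exp (-b * ‖x‖ ^ 2) := by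
    rw [← Real.exp_add]; congr 1; ring
  rw [h1]
  have h0 : 0 ≤ Real.exp (b * ‖y‖ ^ 2) * Real.exp (-b * ‖x‖ ^ 2) * Real.exp (2 * π * ⟪y, p⟫) := by
    positivity
  calc ‖F (cpt x y)‖ * (Real.exp (b * ‖y‖ ^ 2) * Real.exp (-b * ‖x‖ ^ 2)) * Real.exp (2 * π * ⟪y, p⟫)
      = ‖F (cpt x y)‖ * (Real.exp (b * ‖y‖ ^ 2) * Real.exp (-b * ‖x‖ ^ 2) * Real.exp (2 * π * ⟪y, p⟫)) := by
        ring
    _ ≤ M * (Real.exp (b * ‖y‖ ^ 2) * Real.exp (-b * ‖x‖ ^ 2) * Real.exp (2 * π * ⟪y, p⟫)) :=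
        mul_le_mul_of_nonneg_right hM h0
    _ = _ := by ring

/-- Norm of the slice under a bound `‖F(x+iy)‖ ≤ M`. [folklore] -/
theorem norm_slice_le {M : ℝ} {x y : 𝕍} (hM : ‖F (cpt x y)‖ ≤ M) :
    ‖slice F b y x‖ ≤ M * Real.exp (b * ‖y‖ ^ 2) * Real.exp (-b * ‖x‖ ^ 2) := by
  rw [slice, norm_mul, norm_gw_cpt]
  have h1 : Real.exp (-b * (‖x‖ ^ 2 - ‖y‖ ^ 2)) = Real.exp (b * ‖y‖ ^ 2) * Real.exp (-b * ‖x‖ ^ 2) := by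
    rw [← Real.exp_add]; congr 1; ring
  rw [h1, ← mul_assoc]
  exact mul_le_mul_of_nonneg_right (mul_le_mul_of_nonneg_right hM (Real.exp_pos _).le)
    (Real.exp_pos _).le

/-- The Gaussian `e^{-b‖x‖²}` is integrable on `ℝᵏ` (`b > 0`). [folklore] -/
theorem integrable_exp_neg_mul_sq_norm {b : ℝ} (hb : 0 < b) :
    Integrable fun x : 𝕍 => Real.exp (-b * ‖x‖ ^ 2) := by
  have h := GaussianFourier.integrable_cexp_neg_mul_sq_norm_add (V := 𝕍) (b := b)
    (by simpa using hb) 0 0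
  simp only [zero_mul, add_zero] at h
  have h2 := h.norm
  refine h2.congr (Eventually.of_forall fun x => ?_)
  simp only [Complex.norm_exp]
  congr 1
  rw [show (-(b : ℂ) * ((‖x‖ : ℂ)) ^ 2) = (((-b * ‖x‖ ^ 2 : ℝ)) : ℂ) by push_cast; ring]
  exact Complex.ofReal_re _

/-- `∫ e^{-b‖x‖²} dx = (π/b)^{k/2}`. [folklore] -/
theorem integral_exp_neg_mul_sq_norm {b : ℝ} (hb : 0 < b) :
    ∫ x : 𝕍, Real.exp (-b * ‖x‖ ^ 2) = (π / b) ^ ((k : ℝ) / 2) := by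
  rw [GaussianFourier.integral_rexp_neg_mul_sq_norm hb]
  simp

/-- The slice at a bounded height is continuous when `F` is continuous on the tube. [folklore] -/
theorem continuous_slice {B : Set 𝕍} (hFc : ContinuousOn F (tube B)) {y : 𝕍} (hy : y ∈ B) :
    Continuous (slice F b y) := by
  have h1 : Continuous fun x : 𝕍 => F (cpt x y) :=
    hFc.comp_continuous (continuous_cpt_left y) fun x => cpt_mem_tube.2 hy
  exact h1.mul ((continuous_gw b).comp (continuous_cpt_left y))

/-- The slice at a bounded height is integrable. [folklore] -/
theorem integrable_slice (hb : 0 < b) {B : Set 𝕍} (hFc : ContinuousOn F (tube B)) {y : 𝕍} (hy : y ∈ B)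
    {M : ℝ} (hM : ∀ x, ‖F (cpt x y)‖ ≤ M) : Integrable (slice F b y) := by
  refine Integrable.mono' (((integrable_exp_neg_mul_sq_norm hb).const_mul
    (M * Real.exp (b * ‖y‖ ^ 2)))) (continuous_slice hFc hy).aestronglyMeasurable
    (Eventually.of_forall fun x => ?_)
  exact norm_slice_le (hM x)

/-- The integrand along the slice at a bounded height is integrable. [folklore] -/
theorem integrable_integrand_cpt (hb : 0 < b) {B : Set 𝕍} (hFc : ContinuousOn F (tube B)) {y : 𝕍}
    (hy : y ∈ B) {M : ℝ} (hM : ∀ x, ‖F (cpt x y)‖ ≤ M) (p : 𝕍) :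
    Integrable fun x : 𝕍 => integrand F b p (cpt x y) := by
  simp_rw [integrand_cpt]
  refine Integrable.const_mul ?_ _
  have h := (Real.fourierIntegral_convergent_iff (μ := volume) (f := slice F b y) p).2
    (integrable_slice hb hFc hy hM)
  refine h.congr (Eventually.of_forall fun x => ?_)
  simp only [Circle.smul_def, Real.fourierChar_apply, smul_eq_mul]
  congr 1
  push_cast
  ring_nf

/-- **The trivial bound on the windowed Fourier data**:
`‖Ψ_y(p)‖ ≤ M e^{b‖y‖²} (π/b)^{k/2} e^{2π y·p}` if `‖F(x + iy)‖ ≤ M` for all `x`. [folklore] -/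
theorem norm_windowFT_le (hb : 0 < b) {y : 𝕍} {M : ℝ} (hM : ∀ x, ‖F (cpt x y)‖ ≤ M) (p : 𝕍) :
    ‖windowFT F b y p‖ ≤
      M * Real.exp (b * ‖y‖ ^ 2) * (π / b) ^ ((k : ℝ) / 2) * Real.exp (2 * π * ⟪y, p⟫) := by
  rw [windowFT]
  refine (norm_integral_le_integral_norm _).trans ?_
  have hle : ∀ x, ‖integrand F b p (cpt x y)‖ ≤
      M * Real.exp (b * ‖y‖ ^ 2) * Real.exp (2 * π * ⟪y, p⟫) * Real.exp (-b * ‖x‖ ^ 2) :=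
    fun x => norm_integrand_cpt_le (hM x)
  have hint : Integrable fun x : 𝕍 =>
      M * Real.exp (b * ‖y‖ ^ 2) * Real.exp (2 * π * ⟪y, p⟫) * Real.exp (-b * ‖x‖ ^ 2) :=
    (integrable_exp_neg_mul_sq_norm hb).const_mul _
  refine (integral_mono_of_nonneg (Eventually.of_forall fun x => norm_nonneg _) hint
    (Eventually.of_forall hle)).trans ?_
  rw [integral_const_mul, integral_exp_neg_mul_sq_norm hb]
  exact le_of_eq (by ring)


/-! ### Height independence -/

/-- A real direction `v ∈ ℝᵏ` regarded as a vector of `ℂᵏ`. [folklore] -/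
def cvec (v : 𝕍) : Fin k → ℂ := fun j => (v j : ℂ)

/-- Coordinates of `cvec`. [folklore] -/
@[simp] theorem cvec_apply (v : 𝕍) (j : Fin k) : cvec v j = (v j : ℂ) := rfl

/-- `(x + iy) + κ v = (x + (Re κ) v) + i (y + (Im κ) v)`. [folklore] -/
theorem cpt_add_smul_cvec (x y v : 𝕍) (κ : ℂ) :
    cpt x y + κ • cvec v = cpt (x + κ.re • v) (y + κ.im • v) := by
  funext j
  simp only [Pi.add_apply, Pi.smul_apply, cpt_apply, cvec_apply, smul_eq_mul, PiLp.add_apply,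
    PiLp.smul_apply]
  conv_lhs => rw [← Complex.re_add_im κ]
  push_cast
  ring

/-- Elementary Gaussian comparison: `e^{-b‖x + c‖²} ≤ e^{bρ²} e^{-(b/2)‖x + c₀‖²}` when
`‖c - c₀‖ ≤ ρ`. [folklore] -/
theorem exp_neg_mul_sq_norm_add_le {b ρ : ℝ} (hb : 0 ≤ b) (x c c₀ : 𝕍) (hc : ‖c - c₀‖ ≤ ρ) :
    Real.exp (-b * ‖x + c‖ ^ 2) ≤ Real.exp (b * ρ ^ 2) * Real.exp (-(b / 2) * ‖x + c₀‖ ^ 2) := by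
  rw [← Real.exp_add]
  refine Real.exp_le_exp.2 ?_
  have h1 : ‖x + c₀‖ ≤ ‖x + c‖ + ‖c - c₀‖ := by
    calc ‖x + c₀‖ = ‖(x + c) - (c - c₀)‖ := by congr 1; abel
      _ ≤ ‖x + c‖ + ‖c - c₀‖ := norm_sub_le _ _
  have h2 : ‖x + c₀‖ ≤ ‖x + c‖ + ρ := h1.trans (by linarith)
  have h3 : ‖x + c₀‖ ^ 2 ≤ (‖x + c‖ + ρ) ^ 2 := pow_le_pow_left₀ (norm_nonneg _) h2 2
  have hρ : 0 ≤ ρ := (norm_nonneg _).trans hc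
  have h4 : (‖x + c‖ + ρ) ^ 2 ≤ 2 * ‖x + c‖ ^ 2 + 2 * ρ ^ 2 := by
    nlinarith [sq_nonneg (‖x + c‖ - ρ)]
  nlinarith [h3.trans h4, norm_nonneg (x + c), norm_nonneg (x + c₀)]

/-- `‖y + t v‖ ≤ ‖y‖ + T ‖v‖` for `|t| ≤ T`. [folklore] -/
theorem norm_add_smul_le {y v : 𝕍} {t T : ℝ} (ht : |t| ≤ T) : ‖y + t • v‖ ≤ ‖y‖ + T * ‖v‖ := by
  calc ‖y + t • v‖ ≤ ‖y‖ + ‖t • v‖ := norm_add_le _ _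
    _ = ‖y‖ + |t| * ‖v‖ := by rw [norm_smul, Real.norm_eq_abs]
    _ ≤ ‖y‖ + T * ‖v‖ := by gcongr

/-- Membership in the closed `δ`-thickening of `[0, 1]`. [folklore] -/
theorem mem_cthickening_Icc {δ s : ℝ} (hδ : 0 < δ) (h1 : -δ ≤ s) (h2 : s ≤ 1 + δ) :
    s ∈ cthickening δ (Icc (0 : ℝ) 1) := by
  refine Metric.mem_cthickening_of_dist_le s (max 0 (min s 1)) δ _
    ⟨le_max_left _ _, max_le zero_le_one (min_le_right _ _)⟩ ?_
  rw [Real.dist_eq]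
  rcases le_total s 0 with hs0 | hs0
  · rw [min_eq_left (hs0.trans zero_le_one), max_eq_left hs0, sub_zero, abs_of_nonpos hs0]
    linarith
  · rcases le_total s 1 with hs1 | hs1
    · rw [min_eq_left hs1, max_eq_right hs0, sub_self, abs_zero]
      exact hδ.le
    · rw [min_eq_right hs1, max_eq_right zero_le_one, abs_of_nonneg (by linarith)]
      linarith

section Height

/-- **Height independence of the windowed Fourier data along a segment.** If `F` is holomorphic
on the tube over an open `B`, bounded on the tubes over compact subsets of `B`, and the segment
`y + [0, 1] v` lies in `B`, then `Ψ_{y + v} = Ψ_y`. The function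
`g(κ) = ∫ H_p((x + iy) + κ v) dx` is holomorphic in the strip `{-δ < Im κ < 1 + δ}` (dominated
holomorphic parameter integral), constant on the real axis (translation invariance of Lebesgue
measure), hence constant, and `g(i) = Ψ_{y+v}(p)`, `g(0) = Ψ_y(p)`. [folklore] -/
theorem windowFT_add_eq (hb : 0 < b) {B : Set 𝕍} (hBo : IsOpen B) (hFd : DifferentiableOn ℂ F (tube B))
    (hbd : ∀ K ⊆ B, IsCompact K → ∃ M : ℝ, ∀ x, ∀ y ∈ K, ‖F (cpt x y)‖ ≤ M) {y v : 𝕍}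
    (hseg : ∀ s ∈ Icc (0 : ℝ) 1, y + s • v ∈ B) (p : 𝕍) :
    windowFT F b (y + v) p = windowFT F b y p := by
  -- a thickened segment of heights inside `B`
  have hγ : Continuous fun s : ℝ => y + s • v := continuous_const.add (continuous_id.smul continuous_const)
  have hSo : IsOpen {s : ℝ | y + s • v ∈ B} := hBo.preimage hγ
  obtain ⟨δ, hδ, hδS⟩ := isCompact_Icc.exists_cthickening_subset_open hSo
    (fun s hs => hseg s hs : Icc (0 : ℝ) 1 ⊆ {s : ℝ | y + s • v ∈ B})
  have hmemB : ∀ s : ℝ, -δ ≤ s → s ≤ 1 + δ → y + s • v ∈ B := fun s h1 h2 =>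
    hδS (mem_cthickening_Icc hδ h1 h2)
  set K : Set 𝕍 := (fun s : ℝ => y + s • v) '' Icc (-δ) (1 + δ) with hK
  have hKc : IsCompact K := isCompact_Icc.image hγ
  have hKB : K ⊆ B := by
    rintro _ ⟨s, hs, rfl⟩
    exact hmemB s hs.1 hs.2
  obtain ⟨M, hM⟩ := hbd K hKB hKc
  have hMK : ∀ (x : 𝕍) (s : ℝ), -δ ≤ s → s ≤ 1 + δ → ‖F (cpt x (y + s • v))‖ ≤ M :=
    fun x s h1 h2 => hM x _ ⟨s, ⟨h1, h2⟩, rfl⟩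
  -- the strip
  set U : Set ℂ := {κ : ℂ | -δ < κ.im} ∩ {κ : ℂ | κ.im < 1 + δ} with hU
  have hUo : IsOpen U :=
    (isOpen_lt continuous_const Complex.continuous_im).inter
      (isOpen_lt Complex.continuous_im continuous_const)
  have him : IsLinearMap ℝ fun w : ℂ => w.im :=
    ⟨fun u w => Complex.add_im u w, fun c u => Complex.smul_im c u⟩
  have hUc : Convex ℝ U := (convex_halfSpace_gt him _).inter (convex_halfSpace_lt him _)
  have hmapU : ∀ κ ∈ U, ∀ x : 𝕍, cpt x y + κ • cvec v ∈ tube B := by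
    intro κ hκ x
    rw [cpt_add_smul_cvec, cpt_mem_tube]
    exact hmemB _ hκ.1.le hκ.2.le
  -- the function `g`
  set g : ℂ → ℂ := fun κ => ∫ x : 𝕍, integrand F b p (cpt x y + κ • cvec v) with hg_def
  -- (1) `g` is holomorphic on the strip
  have hg : DifferentiableOn ℂ g U := by
    refine differentiableOn_integral_of_dominated (μ := (volume : Measure 𝕍)) ?_ ?_ ?_
    · intro κ hκ
      have hc : Continuous fun x : 𝕍 => integrand F b p (cpt x y + κ • cvec v) :=
        (continuousOn_integrand hFd.continuousOn p).comp_continuous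
          ((continuous_cpt_left y).add continuous_const) (hmapU κ hκ)
      exact hc.aestronglyMeasurable
    · refine Eventually.of_forall fun x => ?_
      have haff : Differentiable ℂ fun κ : ℂ => cpt x y + κ • cvec v :=
        (differentiable_const _).add (differentiable_id.smul_const _)
      exact (differentiableOn_integrand hFd p).comp haff.differentiableOn fun κ hκ => hmapU κ hκ x
    · intro κ₀ hκ₀
      obtain ⟨R, hR, hRU⟩ := Metric.isOpen_iff.1 hUo κ₀ hκ₀
      set Y : ℝ := ‖y‖ + (1 + δ) * ‖v‖ with hY
      set C : ℝ := M * Real.exp (b * Y ^ 2) * Real.exp (2 * π * (Y * ‖p‖)) *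
        Real.exp (b * (R * ‖v‖) ^ 2) with hC
      refine ⟨R, hR, hRU, fun x => C * Real.exp (-(b / 2) * ‖x + κ₀.re • v‖ ^ 2), ?_, ?_⟩
      · exact ((integrable_exp_neg_mul_sq_norm (half_pos hb)).comp_add_right (κ₀.re • v)).const_mul C
      · refine Eventually.of_forall fun x κ hκ => ?_
        have hκU : κ ∈ U := hRU hκ
        rw [cpt_add_smul_cvec]
        refine (norm_integrand_cpt_le (hMK _ _ hκU.1.le hκU.2.le)).trans ?_
        -- the height `y' = y + Im κ v` has norm `≤ Y`
        have hκ1 : -δ < κ.im := hκU.1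
        have hκ2 : κ.im < 1 + δ := hκU.2
        have habs : |κ.im| ≤ 1 + δ := abs_le.2 ⟨by linarith, hκ2.le⟩
        have hy' : ‖y + κ.im • v‖ ≤ Y := norm_add_smul_le habs
        have hY0 : 0 ≤ Y := (norm_nonneg _).trans hy'
        have e1 : Real.exp (b * ‖y + κ.im • v‖ ^ 2) ≤ Real.exp (b * Y ^ 2) := by
          refine Real.exp_le_exp.2 (mul_le_mul_of_nonneg_left ?_ hb.le)
          exact pow_le_pow_left₀ (norm_nonneg _) hy' 2
        have e2 : Real.exp (2 * π * ⟪y + κ.im • v, p⟫) ≤ Real.exp (2 * π * (Y * ‖p‖)) := by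
          refine Real.exp_le_exp.2 (mul_le_mul_of_nonneg_left ?_ (by positivity))
          exact (real_inner_le_norm _ _).trans (mul_le_mul_of_nonneg_right hy' (norm_nonneg _))
        have hcc : ‖κ.re • v - κ₀.re • v‖ ≤ R * ‖v‖ := by
          rw [← sub_smul, norm_smul, Real.norm_eq_abs]
          refine mul_le_mul_of_nonneg_right ?_ (norm_nonneg _)
          have h1 : |κ.re - κ₀.re| ≤ ‖κ - κ₀‖ := by
            simpa using Complex.abs_re_le_norm (κ - κ₀)
          exact h1.trans (mem_ball_iff_norm.1 hκ).le
        have e3 := exp_neg_mul_sq_norm_add_le hb.le x (κ.re • v) (κ₀.re • v) hcc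
        have hM0 : 0 ≤ M := (norm_nonneg _).trans (hMK x _ hκU.1.le hκU.2.le)
        calc M * Real.exp (b * ‖y + κ.im • v‖ ^ 2) * Real.exp (2 * π * ⟪y + κ.im • v, p⟫) *
              Real.exp (-b * ‖x + κ.re • v‖ ^ 2)
            ≤ M * Real.exp (b * Y ^ 2) * Real.exp (2 * π * (Y * ‖p‖)) *
              (Real.exp (b * (R * ‖v‖) ^ 2) * Real.exp (-(b / 2) * ‖x + κ₀.re • v‖ ^ 2)) := by
              gcongr
          _ = C * Real.exp (-(b / 2) * ‖x + κ₀.re • v‖ ^ 2) := by rw [hC]; ring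
  -- (2) `g` is constant on the real axis
  have hreal : ∀ u : ℝ, g u = g 0 := by
    intro u
    have h1 : ∀ x : 𝕍, cpt x y + (u : ℂ) • cvec v = cpt (x + u • v) y := fun x => by
      rw [cpt_add_smul_cvec]; simp
    have h0 : ∀ x : 𝕍, cpt x y + (0 : ℂ) • cvec v = cpt x y := fun x => by simp
    simp only [hg_def, h1, h0]
    exact integral_add_right_eq_self (μ := (volume : Measure 𝕍))
      (fun x => integrand F b p (cpt x y)) (u • v)
  -- (3) the identity theorem on the strip
  have h0U : (0 : ℂ) ∈ U := ⟨by simp [hδ], by simp; linarith⟩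
  have hIU : I ∈ U := ⟨by simp; linarith, by simp [hδ]⟩
  have han : AnalyticOnNhd ℂ (fun κ => g κ - g 0) U :=
    (hg.sub (differentiableOn_const _)).analyticOnNhd hUo
  have hfreq : ∃ᶠ κ in 𝓝[≠] (0 : ℂ), g κ - g 0 = 0 := by
    have htend : Tendsto (fun u : ℝ => (u : ℂ)) (𝓝[≠] 0) (𝓝[≠] 0) := by
      have h1 : Tendsto (fun u : ℝ => (u : ℂ)) (𝓝[≠] 0) (𝓝[{0}ᶜ] ((0 : ℝ) : ℂ)) :=
        continuous_ofReal.continuousWithinAt.tendsto_nhdsWithin fun u hu =>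
          ofReal_ne_zero.2 hu
      simpa using h1
    have hev : ∀ᶠ u : ℝ in 𝓝[≠] 0, g u - g 0 = 0 :=
      Eventually.of_forall fun u => by rw [hreal u, sub_self]
    exact htend.frequently hev.frequently
  have hzero := han.eqOn_zero_of_preconnected_of_frequently_eq_zero hUc.isPreconnected h0U hfreq hIU
  have hgI : g I = windowFT F b (y + v) p := by
    simp only [hg_def, windowFT]
    congr 1
    funext x
    rw [cpt_add_smul_cvec]
    simp
  have hg0 : g 0 = windowFT F b y p := by
    simp only [hg_def, windowFT]
    congr 1
    funext x
    simp
  have h : g I = g 0 := by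
    have h' := hzero
    simp only [Pi.zero_apply, sub_eq_zero] at h'
    exact h'
  rw [← hgI, ← hg0, h]

/-- **Height independence on a star-shaped base**: `Ψ_y = Ψ_0` for every `y ∈ B`, `B` open and
star-shaped with respect to `0`. [folklore] -/
theorem windowFT_eq_windowFT_zero (hb : 0 < b) {B : Set 𝕍} (hBo : IsOpen B) (hst : StarConvex ℝ 0 B)
    (hFd : DifferentiableOn ℂ F (tube B))
    (hbd : ∀ K ⊆ B, IsCompact K → ∃ M : ℝ, ∀ x, ∀ y ∈ K, ‖F (cpt x y)‖ ≤ M) {y : 𝕍} (hy : y ∈ B)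
    (p : 𝕍) : windowFT F b y p = windowFT F b 0 p := by
  have h := windowFT_add_eq hb hBo hFd hbd (y := 0) (v := y) (fun s hs => ?_) p
  · simpa using h
  · have hmem := hst hy (sub_nonneg.2 hs.2) hs.1 (sub_add_cancel 1 s)
    simpa using hmem

end Height


/-! ### Exponential decay from finitely many surrounding heights -/

/-- `e^{-c‖p‖}` is integrable on `ℝᵏ` (`c > 0`). [folklore] -/
theorem integrable_exp_neg_mul_norm {c : ℝ} (hc : 0 < c) :
    Integrable fun p : 𝕍 => Real.exp (-(c * ‖p‖)) := by
  have hdim : (Module.finrank ℝ 𝕍 : ℝ) < (k + 1 : ℕ) := by simp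
  have hint : Integrable (fun p : 𝕍 => (1 + ‖p‖) ^ (-((k + 1 : ℕ) : ℝ))) :=
    integrable_one_add_norm hdim
  set K : ℝ := (k + 1).factorial * c⁻¹ ^ (k + 1) * Real.exp c with hK
  refine (hint.const_mul K).mono' (by fun_prop) (Eventually.of_forall fun p => ?_)
  rw [Real.norm_eq_abs, abs_of_nonneg (Real.exp_pos _).le]
  have h := one_add_pow_mul_exp_neg_le hc (k + 1) (norm_nonneg p)
  have hpos : 0 < (1 + ‖p‖) ^ (k + 1) := by positivity
  rw [Real.rpow_neg (by positivity), Real.rpow_natCast, le_mul_inv_iff₀ hpos]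
  calc Real.exp (-(c * ‖p‖)) * (1 + ‖p‖) ^ (k + 1)
      = (1 + ‖p‖) ^ (k + 1) * Real.exp (-c * ‖p‖) := by rw [neg_mul]; ring
    _ ≤ K := h

/-- **Exponential decay of the windowed Fourier data at a surrounded point.** Let the finitely
many heights `y ∈ S ⊆ B` *`δ`-surround* `y⋆`: for every `p` some `y ∈ S` has
`(y - y⋆)·p ≤ -δ‖p‖`. If `‖F(x + iy)‖ ≤ M` and `‖y‖ ≤ Y` for `y ∈ S`, then
`‖Ψ_0(p)‖ ≤ M e^{bY²} (π/b)^{k/2} e^{2π y⋆·p} e^{-2πδ‖p‖}`: by height independence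
`Ψ_0 = Ψ_y` for the best `y ∈ S`, and the trivial bound at height `y`. (The minimum over the
surrounding heights is where the convex hull enters.) [folklore] -/
theorem norm_windowFT_zero_le_of_surround (hb : 0 < b) {B : Set 𝕍} (hBo : IsOpen B)
    (hst : StarConvex ℝ 0 B) (hFd : DifferentiableOn ℂ F (tube B))
    (hbd : ∀ K ⊆ B, IsCompact K → ∃ M : ℝ, ∀ x, ∀ y ∈ K, ‖F (cpt x y)‖ ≤ M)
    {S : Finset 𝕍} (hSB : ∀ y ∈ S, y ∈ B) {ystar : 𝕍} {δ : ℝ}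
    (hsur : ∀ p : 𝕍, ∃ y ∈ S, ⟪y - ystar, p⟫ ≤ -(δ * ‖p‖))
    {M Y : ℝ} (hM : ∀ x, ∀ y ∈ S, ‖F (cpt x y)‖ ≤ M) (hY : ∀ y ∈ S, ‖y‖ ≤ Y) (p : 𝕍) :
    ‖windowFT F b 0 p‖ ≤ M * Real.exp (b * Y ^ 2) * (π / b) ^ ((k : ℝ) / 2) *
      Real.exp (2 * π * ⟪ystar, p⟫) * Real.exp (-(2 * π * δ * ‖p‖)) := by
  obtain ⟨y, hyS, hyp⟩ := hsur p
  rw [← windowFT_eq_windowFT_zero hb hBo hst hFd hbd (hSB y hyS) p]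
  refine (norm_windowFT_le hb (fun x => hM x y hyS) p).trans ?_
  have hM0 : 0 ≤ M := (norm_nonneg _).trans (hM 0 y hyS)
  have e1 : Real.exp (b * ‖y‖ ^ 2) ≤ Real.exp (b * Y ^ 2) := by
    refine Real.exp_le_exp.2 (mul_le_mul_of_nonneg_left ?_ hb.le)
    exact pow_le_pow_left₀ (norm_nonneg _) (hY y hyS) 2
  have e2 : Real.exp (2 * π * ⟪y, p⟫) ≤
      Real.exp (2 * π * ⟪ystar, p⟫) * Real.exp (-(2 * π * δ * ‖p‖)) := by
    rw [← Real.exp_add]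
    refine Real.exp_le_exp.2 ?_
    rw [inner_sub_left] at hyp
    nlinarith [hyp, Real.pi_pos]
  calc M * Real.exp (b * ‖y‖ ^ 2) * (π / b) ^ ((k : ℝ) / 2) * Real.exp (2 * π * ⟪y, p⟫)
      ≤ M * Real.exp (b * Y ^ 2) * (π / b) ^ ((k : ℝ) / 2) *
        (Real.exp (2 * π * ⟪ystar, p⟫) * Real.exp (-(2 * π * δ * ‖p‖))) := by
        gcongr
    _ = _ := by ring

/-- In `ℝᵏ`, `k ≥ 1`, some coordinate carries the Euclidean norm: `‖p‖ ≤ √k |p_j|` for the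
largest `|p_j|`. [folklore] -/
theorem exists_norm_le_sqrt_mul_abs [Nonempty (Fin k)] (p : 𝕍) :
    ∃ j : Fin k, ‖p‖ ≤ Real.sqrt k * |p j| := by
  obtain ⟨j, -, hj⟩ := Finset.exists_max_image Finset.univ (fun j : Fin k => |p j|)
    Finset.univ_nonempty
  refine ⟨j, ?_⟩
  have h1 : ‖p‖ ^ 2 ≤ (Real.sqrt k * |p j|) ^ 2 := by
    rw [EuclideanSpace.norm_sq_eq, mul_pow, Real.sq_sqrt (Nat.cast_nonneg _)]
    calc ∑ l, ‖p l‖ ^ 2 ≤ ∑ _l : Fin k, |p j| ^ 2 :=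
          Finset.sum_le_sum fun l _ => by
            rw [Real.norm_eq_abs]
            exact pow_le_pow_left₀ (abs_nonneg _) (hj l (Finset.mem_univ _)) 2
      _ = (k : ℝ) * |p j| ^ 2 := by simp
  exact le_of_pow_le_pow_left₀ two_ne_zero (by positivity) h1

/-- **Every point of the convex hull of an open set is surrounded by finitely many points of the
set.** If `y⋆ = ∑ λᵢ zᵢ` (`zᵢ ∈ B`) and the balls `B(zᵢ, r)` lie in `B`, the `2k·#I` points
`zᵢ ± r e_j` do: given `p`, some `i` has `(zᵢ - y⋆)·p ≤ 0` (the `λ`-average vanishes) and the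
largest coordinate `|p_j| ≥ ‖p‖/√k` fixes `j` and the sign. [folklore] -/
theorem exists_surround_of_mem_convexHull {B : Set 𝕍} (hBo : IsOpen B) {ystar : 𝕍}
    (hy : ystar ∈ convexHull ℝ B) :
    ∃ (S : Finset 𝕍) (δ : ℝ), 0 < δ ∧ (∀ y ∈ S, y ∈ B) ∧
      ∀ p : 𝕍, ∃ y ∈ S, ⟪y - ystar, p⟫ ≤ -(δ * ‖p‖) := by
  classical
  rw [convexHull_eq] at hy
  obtain ⟨ι, t, w, z, hw0, hw1, hzB, hcm⟩ := hy
  have htne : t.Nonempty := by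
    by_contra h
    rw [Finset.not_nonempty_iff_eq_empty] at h
    simp [h] at hw1
  -- a common radius
  set K₀ : Set 𝕍 := ((t.image z : Finset 𝕍) : Set 𝕍) with hK₀
  have hK₀B : K₀ ⊆ B := by
    intro y hy
    rw [hK₀, Finset.coe_image] at hy
    obtain ⟨i, hi, rfl⟩ := hy
    exact hzB i hi
  obtain ⟨r, hr, hrB⟩ := (t.image z).finite_toSet.isCompact.exists_cthickening_subset_open hBo hK₀B
  have hmem : ∀ i ∈ t, ∀ u : 𝕍, ‖u‖ ≤ r → z i + u ∈ B := by
    intro i hi u hu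
    refine hrB (Metric.mem_cthickening_of_dist_le (z i + u) (z i) r K₀ ?_ ?_)
    · rw [hK₀, Finset.coe_image]
      exact ⟨i, hi, rfl⟩
    · simpa [dist_eq_norm] using hu
  -- the surrounding set: centres and the `2k` displaced copies
  set e : Fin k → 𝕍 := fun j => EuclideanSpace.single j (1 : ℝ) with he
  have hne : ∀ j, ‖r • e j‖ = r := fun j => by
    rw [norm_smul, Real.norm_eq_abs, abs_of_pos hr, he]
    simp
  set S : Finset 𝕍 := t.image z ∪
    ((t ×ˢ (Finset.univ : Finset (Fin k))).image fun q => z q.1 + r • e q.2) ∪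
    ((t ×ˢ (Finset.univ : Finset (Fin k))).image fun q => z q.1 - r • e q.2) with hS
  refine ⟨S, r / (Real.sqrt k + 1), by positivity, ?_, fun p => ?_⟩
  · intro y hyS
    simp only [hS, Finset.mem_union, Finset.mem_image, Finset.mem_product, Finset.mem_univ,
      and_true, Prod.exists] at hyS
    rcases hyS with (⟨i, hi, rfl⟩ | ⟨i, j, hi, rfl⟩) | ⟨i, j, hi, rfl⟩
    · simpa using hmem i hi 0 (by simp [hr.le])
    · exact hmem i hi _ (hne j).le
    · rw [sub_eq_add_neg]
      exact hmem i hi _ (by rw [norm_neg]; exact (hne j).le)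
  -- a centre on the right side of `p`
  have hcentre : ∃ i ∈ t, ⟪z i - ystar, p⟫ ≤ 0 := by
    by_contra hcon
    push Not at hcon
    have hsum : ∑ i ∈ t, w i * ⟪z i - ystar, p⟫ = 0 := by
      have h1 : ∑ i ∈ t, w i * ⟪z i - ystar, p⟫ = ⟪∑ i ∈ t, w i • (z i - ystar), p⟫ := by
        rw [sum_inner]
        refine Finset.sum_congr rfl fun i _ => ?_
        rw [real_inner_smul_left]
      rw [h1]
      have h2 : ∑ i ∈ t, w i • (z i - ystar) = 0 := by
        simp_rw [smul_sub, Finset.sum_sub_distrib, ← Finset.sum_smul, hw1, one_smul]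
        rw [← Finset.centerMass_eq_of_sum_1 _ _ hw1, hcm, sub_self]
      rw [h2, inner_zero_left]
    obtain ⟨i₀, hi₀, hwi₀⟩ : ∃ i ∈ t, 0 < w i := by
      by_contra hneg
      push Not at hneg
      have : ∑ i ∈ t, w i ≤ 0 := Finset.sum_nonpos hneg
      linarith
    have hpos : 0 < ∑ i ∈ t, w i * ⟪z i - ystar, p⟫ :=
      Finset.sum_pos' (fun i hi => mul_nonneg (hw0 i hi) (hcon i hi).le)
        ⟨i₀, hi₀, mul_pos hwi₀ (hcon i₀ hi₀)⟩
    linarith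
  obtain ⟨i, hi, hip⟩ := hcentre
  -- the degenerate direction
  by_cases hp : p = 0
  · refine ⟨z i, Finset.mem_union_left _ (Finset.mem_union_left _ (Finset.mem_image_of_mem z hi)), ?_⟩
    simp [hp]
  -- the best coordinate
  have hk : Nonempty (Fin k) := by
    by_contra hk
    rw [not_nonempty_iff] at hk
    exact hp (Subsingleton.elim _ _)
  obtain ⟨j, hj⟩ := exists_norm_le_sqrt_mul_abs p
  have hinner : ∀ c : ℝ, ⟪c • e j, p⟫ = c * p j := fun c => by
    rw [real_inner_smul_left, he, EuclideanSpace.inner_single_left]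
    simp
  have hkey : r * |p j| ≥ r / (Real.sqrt k + 1) * ‖p‖ := by
    rw [ge_iff_le, div_mul_eq_mul_div, div_le_iff₀ (by positivity)]
    have h1 : ‖p‖ ≤ (Real.sqrt k + 1) * |p j| := by
      nlinarith [hj, abs_nonneg (p j), Real.sqrt_nonneg (k : ℝ)]
    nlinarith [h1, hr]
  rcases le_or_gt 0 (p j) with hpj | hpj
  · refine ⟨z i - r • e j, Finset.mem_union_right _ (Finset.mem_image.2
      ⟨(i, j), Finset.mem_product.2 ⟨hi, Finset.mem_univ _⟩, rfl⟩), ?_⟩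
    have h1 : ⟪z i - r • e j - ystar, p⟫ = ⟪z i - ystar, p⟫ - r * p j := by
      rw [show z i - r • e j - ystar = (z i - ystar) - r • e j by abel, inner_sub_left, hinner]
    rw [h1]
    rw [abs_of_nonneg hpj] at hkey
    linarith
  · refine ⟨z i + r • e j, Finset.mem_union_left _ (Finset.mem_union_right _ (Finset.mem_image.2
      ⟨(i, j), Finset.mem_product.2 ⟨hi, Finset.mem_univ _⟩, rfl⟩)), ?_⟩
    have h1 : ⟪z i + r • e j - ystar, p⟫ = ⟪z i - ystar, p⟫ + r * p j := by
      rw [show z i + r • e j - ystar = (z i - ystar) + r • e j by abel, inner_add_left, hinner]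
    rw [h1]
    rw [abs_of_neg hpj] at hkey
    linarith

/-! ### Fourier inversion on the tube -/

/-- The decay bound packaged: at every point of `conv B` the windowed Fourier data decay
exponentially, `‖Ψ_0(p)‖ ≤ A e^{2π y⋆·p} e^{-2πδ‖p‖}`. [folklore] -/
theorem exists_norm_windowFT_zero_le (hb : 0 < b) {B : Set 𝕍} (hBo : IsOpen B)
    (hst : StarConvex ℝ 0 B) (hFd : DifferentiableOn ℂ F (tube B))
    (hbd : ∀ K ⊆ B, IsCompact K → ∃ M : ℝ, ∀ x, ∀ y ∈ K, ‖F (cpt x y)‖ ≤ M)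
    {ystar : 𝕍} (hy : ystar ∈ convexHull ℝ B) :
    ∃ (A δ : ℝ), 0 < δ ∧ ∀ p : 𝕍,
      ‖windowFT F b 0 p‖ ≤ A * Real.exp (2 * π * ⟪ystar, p⟫) * Real.exp (-(2 * π * δ * ‖p‖)) := by
  obtain ⟨S, δ, hδ, hSB, hsur⟩ := exists_surround_of_mem_convexHull hBo hy
  obtain ⟨M, hM⟩ := hbd (S : Set 𝕍) (fun y hy => hSB y hy) S.finite_toSet.isCompact
  refine ⟨M * Real.exp (b * (∑ y ∈ S, ‖y‖) ^ 2) * (π / b) ^ ((k : ℝ) / 2), δ, hδ, fun p => ?_⟩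
  exact norm_windowFT_zero_le_of_surround hb hBo hst hFd hbd hSB hsur (fun x y hy => hM x y hy)
    (fun y hy => Finset.single_le_sum (f := fun y => ‖y‖) (fun _ _ => norm_nonneg _) hy) p

/-- The Fourier–Laplace kernel at `z = x + iy`: `e^{2πi ∑ p_j z_j} = e^{2πi x·p} e^{-2π y·p}`. [folklore] -/
theorem cexp_two_pi_I_sum_cpt (p x y : 𝕍) :
    cexp (2 * π * I * ∑ j, (p j : ℂ) * cpt x y j) =
      cexp (↑(2 * π * ⟪x, p⟫) * I) * (Real.exp (-(2 * π * ⟪y, p⟫)) : ℂ) := by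
  rw [sum_mul_cpt, Complex.ofReal_exp, ← Complex.exp_add]
  congr 1
  push_cast
  ring_nf
  rw [Complex.I_sq]
  ring

/-- Modulus of the Fourier–Laplace kernel: `|e^{2πi ∑ p_j z_j}| = e^{-2π (Im z)·p}`. [folklore] -/
theorem norm_cexp_two_pi_I_sum (p : 𝕍) (z : Fin k → ℂ) :
    ‖cexp (2 * π * I * ∑ j, (p j : ℂ) * z j)‖ = Real.exp (-(2 * π * ⟪imv z, p⟫)) := by
  conv_lhs => rw [← cpt_rev_imv z]
  rw [cexp_two_pi_I_sum_cpt, norm_mul, Complex.norm_exp_ofReal_mul_I, one_mul, Complex.norm_real,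
    Real.norm_eq_abs, abs_of_pos (Real.exp_pos _)]

/-- **Fourier inversion on the tube**: `F(z) G_b(z) = ∫ Ψ_0(p) e^{2πi p·z} dp` for `z ∈ T(B)`.
The slice `x ↦ F(x+iy)G_b(x+iy)` is continuous and integrable and its Fourier transform
`e^{-2π y·p} Ψ_y(p) = e^{-2π y·p} Ψ_0(p)` is integrable by the decay at the point `y ∈ B ⊆ conv B`,
so Mathlib's Fourier inversion theorem applies. [folklore] -/
theorem apply_mul_gw_eq_integral_windowFT (hb : 0 < b) {B : Set 𝕍} (hBo : IsOpen B)
    (hst : StarConvex ℝ 0 B) (hFd : DifferentiableOn ℂ F (tube B))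
    (hbd : ∀ K ⊆ B, IsCompact K → ∃ M : ℝ, ∀ x, ∀ y ∈ K, ‖F (cpt x y)‖ ≤ M)
    {z : Fin k → ℂ} (hz : z ∈ tube B) :
    F z * gw b z = ∫ p : 𝕍, windowFT F b 0 p * cexp (2 * π * I * ∑ j, (p j : ℂ) * z j) := by
  set y : 𝕍 := imv z with hydef
  set x : 𝕍 := rev z with hxdef
  have hy : y ∈ B := hz
  have hzxy : z = cpt x y := (cpt_rev_imv z).symm
  -- bound at height `y` and decay of `Ψ_0`
  obtain ⟨M, hM⟩ := hbd {y} (by simpa using hy) isCompact_singleton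
  have hMy : ∀ x', ‖F (cpt x' y)‖ ≤ M := fun x' => hM x' y rfl
  obtain ⟨A, δ, hδ, hA⟩ := exists_norm_windowFT_zero_le hb hBo hst hFd hbd (subset_convexHull ℝ B hy)
  -- the slice and its Fourier transform
  have hcont : Continuous (slice F b y) := continuous_slice hFd.continuousOn hy
  have hint : Integrable (slice F b y) := integrable_slice hb hFd.continuousOn hy hMy
  have hFT : ∀ p, 𝓕 (slice F b y) p = (Real.exp (-(2 * π * ⟪y, p⟫)) : ℂ) * windowFT F b 0 p := by
    intro p
    rw [← windowFT_eq_windowFT_zero hb hBo hst hFd hbd hy p, windowFT_eq_fourier, ← mul_assoc,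
      ← Complex.ofReal_mul, ← Real.exp_add, neg_add_cancel, Real.exp_zero, Complex.ofReal_one, one_mul]
  have hFTint : Integrable (𝓕 (slice F b y)) := by
    have hc : Continuous (𝓕 (slice F b y)) :=
      VectorFourier.fourierIntegral_continuous Real.continuous_fourierChar (by exact continuous_inner)
        hint
    refine ((integrable_exp_neg_mul_norm (by positivity : 0 < 2 * π * δ)).const_mul A).mono'
      hc.aestronglyMeasurable (Eventually.of_forall fun p => ?_)
    rw [hFT, norm_mul, Complex.norm_real, Real.norm_eq_abs, abs_of_pos (Real.exp_pos _)]
    calc Real.exp (-(2 * π * ⟪y, p⟫)) * ‖windowFT F b 0 p‖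
        ≤ Real.exp (-(2 * π * ⟪y, p⟫)) *
          (A * Real.exp (2 * π * ⟪y, p⟫) * Real.exp (-(2 * π * δ * ‖p‖))) :=
          mul_le_mul_of_nonneg_left (hA p) (Real.exp_pos _).le
      _ = A * Real.exp (-(2 * π * δ * ‖p‖)) := by
          rw [Real.exp_neg]
          field_simp
  -- Fourier inversion
  have hinv := hcont.fourierInv_fourier_eq hint hFTint
  have hx : slice F b y x = 𝓕⁻ (𝓕 (slice F b y)) x := by rw [hinv]
  rw [hzxy, show F (cpt x y) * gw b (cpt x y) = slice F b y x from rfl, hx, Real.fourierInv_eq']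
  congr 1
  funext p
  rw [hFT p, smul_eq_mul, cexp_two_pi_I_sum_cpt, real_inner_comm x p]
  ring

end TubeFourier

end Literature.Analysis.Complex
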